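import Literature.AlgebraicGeometry.Resolution.ArithmeticalThreefoldsDescentHeadRun
import Literature.AlgebraicGeometry.Resolution.ArithmeticalThreefoldsDescentPreStage
import Literature.AlgebraicGeometry.Resolution.ArithmeticalThreefoldsFiniteDenominatorsModels
import Literature.AlgebraicGeometry.Resolution.MonoidalPrincipalizeMaximalIdeal
import HarnessLib

/-!
# Cossart–Piltant 2019, Prop. 4.8: (LU) for `A` from a regular model of `Â` at `v̂` with
# `K`-finite denominators

Topic: `Literature/AlgebraicGeometry/Resolution` (proofs only; no new notions, no new named
facts). The final assembly of the computational part of the geometric head of Cossart–Piltant's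
descent (J. Algebra 529 (2019) = arXiv:1412.0868, proof of Prop. 4.8 with Lemma 4.7 and
(510)–(512), arXiv v1 Prop. 4.6 pp. 52–53): GIVEN the model — a regular local ring `S₀`,
excellent of dimension `3`, essentially of finite type over `Â`, inside the formal branch `K̂₁`,
contained in and dominated by the chosen extension `O'` of the rank-one valuation `v`, whose image
is the local ring at the centre of `O'` of a model `Â[t₀]` with `K`-FINITE denominators (in the
source: `𝒪_{Ŷ,ŷ}` for `Ŷ → Spec Â` an isomorphism above `Spec Â_g`) — everything else is done
here: principalization of `𝔪_{S₀}` by two monoidal transforms at the least-value parameter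
(`MonoidalPrincipalizeMaximalIdeal.lean`), the pre-stage (`exists_principalizedFrame_state`),
the loops of Lemma 4.7 along `v̂` with the suppliers on the ring of `K`-finite-denominator
fractions, (511), (512) by density and the end of the proof
(`exists_adjoin_isRegularLocalRing_of_principalizedFrame`).

* `exists_adjoin_isRegularLocalRing_of_frameBase` — (LU) for `A` at `v` from such an `S₀` (with
  a regular system of parameters), the rank data of `v` on `K` (`f₁, …, f_r ∈ 𝔪_A` with
  multiplicatively independent values and relations among any `> r` values) and embedded
  resolution of surfaces (`hEmb`, CJS Cor. 1.5).

What is NOT here: the existence of `S₀` (journal Prop. 4.6 / Thm. 1.1 (ii) for `Spec Â`, or a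
local uniformization of `v̂` on `Â/P̂₁` lying in `(Â/P̂₁)_{P∞}`).

## Sources

* V. Cossart, O. Piltant, J. Algebra 529 (2019) 268–535 = arXiv:1412.0868, proof of Prop. 4.8
  with Lemma 4.7 and (510)–(512) (arXiv v1: Prop. 4.6, pp. 52–53). [CossartPiltant2019]
* V. Cossart, O. Piltant, J. Algebra 320 (2008) 1051–1082: Prop. 8.1 (HAL hal-00139124,
  pp. 22–23). [CossartPiltant2008]
-/

noncomputable section

open AlgebraicGeometry CategoryTheory

namespace Literature.AlgebraicGeometry.Resolution

universe u

open IsLocalRing _root_.Polynomial Function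

section Base

variable {A : Type u} [CommRing A] [IsDomain A] [IsLocalRing A] [IsNoetherianRing A]
  {K : Type u} [Field K] [Algebra A K] [IsFractionRing A K]

set_option maxHeartbeats 3200000 in
/-- **(LU) for `A` at `v` from a regular model of `Â` at `v̂` with `K`-finite denominators.**
Data: `A` a Noetherian local domain essentially of finite type over a field `k`, fraction field
`K`, `O` a rank-one valuation ring of `K` containing and dominating `A`, with rank data
`f₁, …, f_r ∈ 𝔪_A` (`r ≥ 1`, values multiplicatively independent, relations among any `> r`
values); `K̂₁`, `ι`, `O'` the chosen formal branch and extension (`O' ⊇ Â`, residues algebraic,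
`O' ∩ K = O`); embedded resolution of surfaces `hEmb`; and THE MODEL: a regular local ring `S₀`,
excellent, of dimension `3`, essentially of finite type over `Â`, mapping injectively to `K̂₁`
(algebraic over it) compatibly with `Â`, contained in and dominated by `O'`, with residues of
`O'` algebraic over it, with a regular system of parameters `s`, and whose image in `K̂₁` is the
local ring `locAtCentre (Â[t₀]) O'` of a model whose generators have `K`-finite denominators.
Conclusion: some finitely generated `A[t] ⊆ O` is regular at the centre of `O`.
[cite: CossartPiltant2019, proof of Prop. 4.8 with Lemma 4.7 and (510)–(512) (arXiv v1: Prop. 4.6, pp. 52–53)]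
[cite: CossartPiltant2008, proof of Prop. 8.1 (HAL pp. 22–23)] -/
theorem exists_adjoin_isRegularLocalRing_of_frameBase
    (k : Type u) [Field k] [Algebra k A] [Algebra.EssFiniteType k A]
    (hEmb : ∀ (Z : Scheme.{u}) [IsIntegral Z] [IsNoetherian Z], Scheme.IsRegular Z →
      Scheme.IsExcellent Z → ∀ (X : Set Z), IsClosed X → X ≠ Set.univ → topologicalKrullDim X ≤ 2 →
        ∃ (Z' : Scheme.{u}) (π : Z' ⟶ Z), IsProper π ∧ Function.Surjective π.base ∧
          (∃ U : Z.Opens, (U : Set Z) = Xᶜ ∧ IsIso (π ∣_ U)) ∧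
          IsStrictNormalCrossingsDivisor Z' (π.base ⁻¹' X))
    (O : ValuationSubring K) (hrk : Nonempty O.valuation.RankOne)
    (hAO : ∀ x : A, algebraMap A K x ∈ O)
    (hdomA : ∀ x ∈ maximalIdeal A, O.valuation (algebraMap A K x) < 1)
    -- rank data of `v` on `K`
    (r : ℕ) (hr0 : 0 < r) (fA : Fin r → A) (hfAm : ∀ i, fA i ∈ maximalIdeal A)
    (hfA0 : ∀ i, algebraMap A K (fA i) ≠ 0)
    (hind : ∀ p m : Fin r → ℕ, ∏ i, O.valuation (algebraMap A K (fA i)) ^ p i =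
      ∏ i, O.valuation (algebraMap A K (fA i)) ^ m i → p = m)
    (hdepK : ∀ (d : ℕ) (I : Finset (Fin d)) (a : Fin d → K), r < I.card → (∀ k, a k ≠ 0) →
      ∃ c : Fin d → ℤ, (∀ k, k ∉ I → c k = 0) ∧ c ≠ 0 ∧
        ∏ k, O.valuation (a k) ^ (c k).toNat = ∏ k, O.valuation (a k) ^ (-c k).toNat)
    -- the formal branch and the extension
    {K₁ : Type u} [Field K₁] [Algebra (AdicCompletion (maximalIdeal A) A) K₁]
    (hP₁ : RingHom.ker (algebraMap (AdicCompletion (maximalIdeal A) A) K₁) ∈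
      minimalPrimes (AdicCompletion (maximalIdeal A) A))
    (hK₁ : ∀ z : K₁, ∃ a b : AdicCompletion (maximalIdeal A) A,
      z = algebraMap _ K₁ a / algebraMap _ K₁ b)
    (ι : K →+* K₁) (hι : ι.comp (algebraMap A K) =
      (algebraMap (AdicCompletion (maximalIdeal A) A) K₁).comp
        (algebraMap A (AdicCompletion (maximalIdeal A) A)))
    (O' : ValuationSubring K₁)
    (hRO' : ∀ x : AdicCompletion (maximalIdeal A) A, algebraMap _ K₁ x ∈ O')
    (halgO' : ∀ y : O', ∃ p : Polynomial (AdicCompletion (maximalIdeal A) A),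
      (∃ i, p.coeff i ∉ (maximalIdeal A).map (algebraMap A (AdicCompletion (maximalIdeal A) A))) ∧
      O'.valuation (p.eval₂ (algebraMap (AdicCompletion (maximalIdeal A) A) K₁) y) < 1)
    (hO : O'.comap ι = O)
    -- the model
    {S₀ : Type u} [CommRing S₀] [IsRegularLocalRing S₀]
    [Algebra (AdicCompletion (maximalIdeal A) A) S₀]
    [Algebra.EssFiniteType (AdicCompletion (maximalIdeal A) A) S₀] [Algebra S₀ K₁]
    [IsScalarTower (AdicCompletion (maximalIdeal A) A) S₀ K₁] [Algebra.IsAlgebraic S₀ K₁]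
    (hS₀ : IsExcellentRing S₀) (hS₀dim : ringKrullDim S₀ = 3)
    (hinj : Function.Injective (algebraMap S₀ K₁))
    (hS₀O : ∀ s : S₀, algebraMap S₀ K₁ s ∈ O')
    (hdomS₀ : ∀ s ∈ maximalIdeal S₀, O'.valuation (algebraMap S₀ K₁ s) < 1)
    (hres : ∀ y : O', ∃ q : S₀[X], (∃ i, q.coeff i ∉ maximalIdeal S₀) ∧
      O'.valuation (q.eval₂ (algebraMap S₀ K₁) y) < 1)
    (s : Fin 3 → S₀) (hs : Ideal.span (Set.range s) = maximalIdeal S₀)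
    (t₀ : Finset K₁)
    (hR₀ : (algebraMap S₀ K₁).range =
      locAtCentre (Algebra.adjoin (AdicCompletion (maximalIdeal A) A) (t₀ : Set K₁)).toSubring O')
    (hden₀ : ∀ z ∈ (t₀ : Set K₁), ∃ a x : AdicCompletion (maximalIdeal A) A,
      (∃ b : K, b ≠ 0 ∧ O'.valuation (ι b) ≤ O'.valuation (algebraMap _ K₁ a)) ∧
        algebraMap _ K₁ a * z = algebraMap _ K₁ x) :
    ∃ (t : Finset K) (h : (Algebra.adjoin A (t : Set K)).toSubring ≤ O.toSubring),
      IsRegularLocalRing (Localization.AtPrime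
        (Ideal.comap (Subring.inclusion h) (maximalIdeal O))) := by
  classical
  haveI : IsDomain S₀ := isDomain_of_isRegularLocalRing S₀
  have hSuc : IsUniversallyCatenaryRing S₀ := hS₀.isUniversallyCatenaryRing
  have hSdim' : ringKrullDim S₀ = (3 : ℕ) := by rw [hS₀dim]; norm_cast
  have hιA : ∀ a : A, algebraMap (AdicCompletion (maximalIdeal A) A) K₁
      (algebraMap A (AdicCompletion (maximalIdeal A) A) a) = ι (algebraMap A K a) := fun a => by
    have := RingHom.congr_fun hι a
    simpa only [RingHom.comp_apply] using this.symm
  have hequiv : O.valuation.IsEquiv (O'.valuation.comap ι) := by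
    rw [Valuation.isEquiv_iff_valuationSubring, ValuationSubring.valuationSubring_valuation]
    ext z
    rw [Valuation.mem_valuationSubring_iff, Valuation.comap_apply,
      ValuationSubring.valuation_le_one_iff, ← ValuationSubring.mem_comap, hO]
  have hpos : ∀ b : K, b ≠ 0 → 0 < O'.valuation (ι b) := fun b hb =>
    zero_lt_iff.mpr ((Valuation.ne_zero_iff _).mpr ((map_ne_zero ι).mpr hb))
  have hvιlt : ∀ a ∈ maximalIdeal A, O'.valuation (ι (algebraMap A K a)) < 1 := fun a ha => by
    have h1 : O.valuation (algebraMap A K a) < O.valuation 1 := by rw [map_one]; exact hdomA a ha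
    have h2 := (hequiv.lt_iff_lt).mp h1
    simpa only [Valuation.comap_apply, map_one] using h2
  -- the image `A_e` of `S₀`: every element of the local ring of the empty model is an image
  set Ae : Subring K₁ := (algebraMap S₀ K₁).range with hAedef
  have hSA : ∀ x : S₀, algebraMap S₀ K₁ x ∈ Ae := fun x => ⟨x, rfl⟩
  have hAS : ∀ y ∈ Ae, ∃ x : S₀, algebraMap S₀ K₁ x = y := fun y hy => hy
  have hÂAe : ∀ x : AdicCompletion (maximalIdeal A) A, algebraMap _ K₁ x ∈ Ae := fun x =>
    ⟨algebraMap _ S₀ x, (IsScalarTower.algebraMap_apply _ S₀ K₁ x).symm⟩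
  have hunitval : ∀ x : S₀, O'.valuation (algebraMap S₀ K₁ x) = 1 → IsUnit x := by
    intro x hx
    by_contra hnu
    exact absurd hx (ne_of_lt (hdomS₀ x ((IsLocalRing.mem_maximalIdeal _).mpr hnu)))
  -- the empty model: `R_∅ = A_e`
  have hTeO : (Algebra.adjoin S₀ ((∅ : Finset K₁) : Set K₁)).toSubring ≤ O'.toSubring :=
    model_toSubring_le_valuationSubring O' hS₀O (by simp)
  have hbot : ∀ y : K₁, y ∈ Algebra.adjoin S₀ ((∅ : Finset K₁) : Set K₁) ↔ y ∈ Ae := by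
    intro y
    rw [Finset.coe_empty, Algebra.adjoin_empty, Algebra.mem_bot]
    exact ⟨fun ⟨x, hx⟩ => ⟨x, hx⟩, fun ⟨x, hx⟩ => ⟨x, hx⟩⟩
  have hRe : ∀ y : K₁, y ∈ locAtCentre (Algebra.adjoin S₀ ((∅ : Finset K₁) : Set K₁)).toSubring O'
      ↔ y ∈ Ae := by
    intro y
    constructor
    · rintro ⟨p, hp, q, hq, hvq, rfl⟩
      obtain ⟨p', rfl⟩ := (hbot p).mp hp
      obtain ⟨q', rfl⟩ := (hbot q).mp hq
      obtain ⟨qu, hqu⟩ := hunitval q' hvq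
      refine ⟨p' * ↑qu⁻¹, ?_⟩
      rw [map_mul, ← hqu, eq_div_iff (by rw [hqu]; exact ne_zero_of_valuation_eq_one hvq),
        mul_assoc, ← map_mul, Units.inv_mul, map_one, mul_one]
    · intro hy
      exact le_locAtCentre _ _ ((hbot y).mpr hy)
  -- the regular parameters of `R_∅`
  haveI := isLocalRing_locAtCentre hTeO
  let e₀ : S₀ →+* locAtCentre (Algebra.adjoin S₀ ((∅ : Finset K₁) : Set K₁)).toSubring O' :=
    (algebraMap S₀ K₁).codRestrict _ fun x => (hRe _).mpr (hSA x)
  have he₀ : Function.Bijective e₀ := by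
    refine ⟨fun x y hxy => hinj (congrArg Subtype.val hxy), fun y => ?_⟩
    obtain ⟨x, hx⟩ := (hRe _).mp y.2
    exact ⟨x, Subtype.ext hx⟩
  let e : S₀ ≃+* locAtCentre (Algebra.adjoin S₀ ((∅ : Finset K₁) : Set K₁)).toSubring O' :=
    RingEquiv.ofBijective e₀ he₀
  have hrege : IsRegularLocalRing
      (locAtCentre (Algebra.adjoin S₀ ((∅ : Finset K₁) : Set K₁)).toSubring O') :=
    IsRegularLocalRing.of_ringEquiv e
  let x₀ : Fin 3 → locAtCentre (Algebra.adjoin S₀ ((∅ : Finset K₁) : Set K₁)).toSubring O' :=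
    fun c => e (s c)
  have hx₀val : ∀ c, (x₀ c : K₁) = algebraMap S₀ K₁ (s c) := fun _ => rfl
  have hx₀ : Ideal.span (Set.range x₀) = maximalIdeal _ := by
    have h1 : Ideal.span (Set.range x₀) = (Ideal.span (Set.range s)).map e := by
      rw [Ideal.map_span, ← Set.range_comp]; rfl
    rw [h1, hs, map_ringEquiv_maximalIdeal]
  -- the parameter of least value
  obtain ⟨a, -, ha⟩ := Finset.exists_max_image Finset.univ
    (fun c => O'.valuation (x₀ c : K₁)) Finset.univ_nonempty
  have hmin : ∀ c, O'.valuation (x₀ c : K₁) ≤ O'.valuation (x₀ a : K₁) :=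
    fun c => ha c (Finset.mem_univ _)
  obtain ⟨b, c, hab, hac, hbc⟩ : ∃ b c : Fin 3, a ≠ b ∧ a ≠ c ∧ b ≠ c := by
    fin_cases a
    · exact ⟨1, 2, by decide, by decide, by decide⟩
    · exact ⟨0, 2, by decide, by decide, by decide⟩
    · exact ⟨0, 1, by decide, by decide, by decide⟩
  -- principalization of `𝔪_{S₀}` by two monoidal transforms
  obtain ⟨hT₁O, hreg₁, hsub₁, hdom₁, hden₁⟩ :=
    exists_frameSteps_maximalIdeal_principal hSuc hinj O' hS₀O hdomS₀ hres hSdim'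
      ((∅ : Finset K₁) : Set K₁) (Finset.finite_toSet _) hTeO hrege x₀ hx₀ a b c hab hac hbc hmin
  set h₀ : K₁ := (x₀ a : K₁) with hh₀def
  have hxa0 : h₀ ≠ 0 :=
    coe_rsop_ne_zero_of_frame hSuc hinj O' hS₀O hdomS₀ hres hSdim' _ (Finset.finite_toSet _) hTeO
      hrege x₀ hx₀ a
  have hh₀A : h₀ ∈ Ae := (hRe _).mp (x₀ a).2
  have hvh₀ : O'.valuation h₀ < 1 := by
    rw [hh₀def, hx₀val]
    exact hdomS₀ _ (hs ▸ Ideal.subset_span ⟨a, rfl⟩)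
  -- the model `t₁` as a finset
  have hS₁fin : (insert ((x₀ c : K₁) / (x₀ a : K₁))
      (insert ((x₀ b : K₁) / (x₀ a : K₁)) ((∅ : Finset K₁) : Set K₁))).Finite :=
    ((Finset.finite_toSet _).insert _).insert _
  set t₁ : Finset K₁ := hS₁fin.toFinset with ht₁def
  have ht₁ : (t₁ : Set K₁) = insert ((x₀ c : K₁) / (x₀ a : K₁))
      (insert ((x₀ b : K₁) / (x₀ a : K₁)) ((∅ : Finset K₁) : Set K₁)) :=
    hS₁fin.coe_toFinset
  have hT₁O' : (Algebra.adjoin S₀ (t₁ : Set K₁)).toSubring ≤ O'.toSubring := by rw [ht₁]; exact hT₁O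
  have hreg₁' : IsRegularLocalRing (locAtCentre (Algebra.adjoin S₀ (t₁ : Set K₁)).toSubring O') := by
    rw [ht₁]; exact hreg₁
  have hAeR₁ : Ae ≤ locAtCentre (Algebra.adjoin S₀ (t₁ : Set K₁)).toSubring O' := by
    intro y hy; rw [ht₁]; exact hsub₁ ((hRe y).mpr hy)
  have hdom₀ : ∀ y ∈ Ae, O'.valuation y < 1 →
      ∃ c' ∈ locAtCentre (Algebra.adjoin S₀ (t₁ : Set K₁)).toSubring O', y = h₀ * c' := by
    intro y hy hvy
    obtain ⟨y', hy', hyy'⟩ := hdom₁ y ((hRe y).mpr hy) hvy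
    exact ⟨y', by rw [ht₁]; exact hy', hyy'⟩
  have hden₁' : ∀ z ∈ (t₁ : Set K₁), h₀ * z ∈ Ae := by
    intro z hz
    refine (hRe _).mp (hden₁ z ?_)
    rw [ht₁] at hz
    rcases hz with rfl | hz
    · exact Or.inr rfl
    · rcases hz with rfl | hz
      · exact Or.inl rfl
      · simp at hz
  -- the denominators of the model and the element `g₀`
  choose ad xd had haxd using hden₀
  set D : K₁ := ∏ z ∈ t₀.attach, algebraMap _ K₁ (ad z.1 z.2) with hDdef
  have hDA : D ∈ Ae := Subring.prod_mem _ fun z _ => hÂAe _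
  have had0 : ∀ (z : K₁) (hz : z ∈ (t₀ : Set K₁)), algebraMap _ K₁ (ad z hz) ≠ 0 := by
    intro z hz h0
    obtain ⟨b', hb', h⟩ := had z hz
    rw [h0, map_zero] at h; exact not_lt.mpr h (hpos b' hb')
  have hD0 : D ≠ 0 := Finset.prod_ne_zero_iff.mpr fun z _ => had0 z.1 z.2
  set fι : Fin r → K₁ := fun i => ι (algebraMap A K (fA i)) with hfιdef
  have hfιA : ∀ i, fι i ∈ Ae := fun i => by rw [hfιdef]; simp only; rw [← hιA]; exact hÂAe _
  have hfι0 : ∀ i, fι i ≠ 0 := fun i => (map_ne_zero ι).mpr (hfA0 i)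
  set g₀ : K₁ := (∏ i, fι i) * D with hg₀def
  have hg₀A : g₀ ∈ Ae := Ae.mul_mem (Subring.prod_mem _ fun i _ => hfιA i) hDA
  have hg₀0 : g₀ ≠ 0 := mul_ne_zero (Finset.prod_ne_zero_iff.mpr fun i _ => hfι0 i) hD0
  have hfg : ∀ i, ∃ c' ∈ Ae, g₀ = fι i * c' := fun i =>
    ⟨(∏ j ∈ Finset.univ.erase i, fι j) * D,
      Ae.mul_mem (Subring.prod_mem _ fun j _ => hfιA j) hDA, by
      rw [hg₀def, ← Finset.mul_prod_erase _ _ (Finset.mem_univ i)]; ring⟩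
  -- the pre-stage
  obtain ⟨t, -, hTO, hreg, hsub, x, hx, F, u, α, w, β, hFA, huR, hvu, hF, hTR, hwR, hvw, hh, hβα,
      hβne, hdomAe, hfR, hfdvd, ⟨cF, hcF, hFg⟩, ⟨M, hM⟩⟩ :=
    exists_principalizedFrame_state hEmb hS₀ hS₀dim hinj O' hS₀O hdomS₀ hres Ae hSA t₁ hT₁O'
      hreg₁' hAeR₁ h₀ hh₀A hxa0 hvh₀ hdom₀ hden₁' g₀ hg₀A hg₀0 fι hfιA hfg
  have hAeR : Ae ≤ locAtCentre (Algebra.adjoin S₀ (t : Set K₁)).toSubring O' := hAeR₁.trans hsub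
  -- `K`-finiteness of `F`
  have hFfin : ∃ b' : K, b' ≠ 0 ∧ O'.valuation (ι b') ≤ O'.valuation F := by
    -- `h₀` is `K`-finite: `ι(f₁) ∈ 𝔪` is `h₀` times an element of `O'`
    let i₀ : Fin r := ⟨0, hr0⟩
    obtain ⟨c₀, hc₀, hfc₀⟩ := hdom₀ (fι i₀) (hfιA i₀) (hvιlt _ (hfAm i₀))
    have hh₀fin : O'.valuation (ι (algebraMap A K (fA i₀))) ≤ O'.valuation h₀ := by
      change O'.valuation (fι i₀) ≤ _
      rw [hfc₀, map_mul]
      exact mul_le_of_le_one_right' ((O'.valuation_le_one_iff _).mpr (locAtCentre_le hT₁O' hc₀))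
    -- `D` is `K`-finite
    have hDfin : O'.valuation (ι (∏ z ∈ t₀.attach, (had z.1 z.2).choose)) ≤ O'.valuation D := by
      rw [map_prod, map_prod, hDdef, map_prod]
      exact Finset.prod_le_prod' fun z _ => (had z.1 z.2).choose_spec.2
    have hD'0 : (∏ z ∈ t₀.attach, (had z.1 z.2).choose) ≠ 0 :=
      Finset.prod_ne_zero_iff.mpr fun z _ => (had z.1 z.2).choose_spec.1
    -- hence `h₀ g₀` and `F`
    refine ⟨(algebraMap A K (fA i₀) * ((∏ i, algebraMap A K (fA i)) *
      ∏ z ∈ t₀.attach, (had z.1 z.2).choose)) ^ M, pow_ne_zero _ (mul_ne_zero (hfA0 i₀)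
        (mul_ne_zero (Finset.prod_ne_zero_iff.mpr fun i _ => hfA0 i) hD'0)), ?_⟩
    refine le_trans ?_ hM
    simp only [map_pow, map_mul]
    refine pow_le_pow_left' (mul_le_mul' hh₀fin ?_) M
    rw [hg₀def, map_mul]
    refine mul_le_mul' (le_of_eq ?_) hDfin
    simp only [map_prod, hfιdef]
  -- the subring of `K`-finite-denominator fractions
  obtain ⟨C, hC, hCA, hCinv, -⟩ := exists_subring_finite_denominators ι hι O'
  have hAC : Ae ≤ C := by
    rw [hR₀]
    exact locAtCentre_adjoin_le_of_finite_denominators ι O' C hC hCA hCinv (t₀ : Set K₁)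
      fun z hz => ⟨ad z hz, xd z hz, had z hz, haxd z hz⟩
  obtain ⟨bF, hbF0, hbF⟩ := hFfin
  have hFC : F⁻¹ ∈ C :=
    inv_mem_of_valuation_le_of_finite_denominators ι O' C hC hCA hCinv (hAC hFA) hbF0 hbF
  -- the denominators of `A_e` relative to `F` ((510))
  let Mden : Submonoid K₁ :=
    { carrier := {d | d ∈ locAtCentre (Algebra.adjoin S₀ (t : Set K₁)).toSubring O' ∧
        ∃ (N : ℕ) (c' : K₁), c' ∈ locAtCentre (Algebra.adjoin S₀ (t : Set K₁)).toSubring O' ∧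
          F ^ N = d * c'}
      one_mem' := ⟨Subring.one_mem _, 0, 1, Subring.one_mem _, by rw [pow_zero, one_mul]⟩
      mul_mem' := by
        rintro d₁ d₂ ⟨hd₁, N₁, c₁, hc₁, h₁⟩ ⟨hd₂, N₂, c₂, hc₂, h₂⟩
        exact ⟨Subring.mul_mem _ hd₁ hd₂, N₁ + N₂, c₁ * c₂, Subring.mul_mem _ hc₁ hc₂, by
          rw [pow_add, h₁, h₂]; ring⟩ }
  have hdenM : ∀ z ∈ (t₀ : Set K₁), ∃ a' : AdicCompletion (maximalIdeal A) A,
      algebraMap _ K₁ a' ∈ Mden ∧ ∃ b' : AdicCompletion (maximalIdeal A) A,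
        algebraMap _ K₁ a' * z = algebraMap _ K₁ b' := by
    intro z hz
    refine ⟨ad z hz, ⟨hAeR (hÂAe _), 1, (∏ w ∈ (t₀.attach).erase ⟨z, hz⟩,
      algebraMap _ K₁ (ad w.1 w.2)) * (∏ i, fι i) * cF, ?_, ?_⟩, xd z hz, haxd z hz⟩
    · exact Subring.mul_mem _ (Subring.mul_mem _ (Subring.prod_mem _ fun w _ => hAeR (hÂAe _))
        (Subring.prod_mem _ fun i _ => hAeR (hfιA i))) hcF
    · rw [pow_one, hFg, hg₀def, hDdef, ← Finset.mul_prod_erase _ _ (Finset.mem_attach _ ⟨z, hz⟩)]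
      ring
  have hden : ∀ y ∈ Ae, ∃ (b' : AdicCompletion (maximalIdeal A) A) (Dy Q : K₁),
      Dy ∈ locAtCentre (Algebra.adjoin S₀ (t : Set K₁)).toSubring O' ∧
      (∃ (N : ℕ) (c' : K₁), c' ∈ locAtCentre (Algebra.adjoin S₀ (t : Set K₁)).toSubring O' ∧
        F ^ N = Dy * c') ∧
      Q ∈ locAtCentre (Algebra.adjoin S₀ (t : Set K₁)).toSubring O' ∧ O'.valuation Q = 1 ∧
      algebraMap _ K₁ b' = Dy * Q * y := by
    intro y hy
    have hy' : y ∈ locAtCentre (Algebra.adjoin (AdicCompletion (maximalIdeal A) A)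
        (t₀ : Set K₁)).toSubring O' := by rw [← hR₀]; exact hy
    obtain ⟨a', Q, ha'M, hQ, hvQ, b', hb'⟩ :=
      exists_mul_mul_mem_range_of_mem_locAtCentre_of_denominators O' (t₀ : Set K₁) Mden hdenM hy'
    have hQAe : Q ∈ Ae := by
      rw [hR₀]
      exact le_locAtCentre _ _ hQ
    exact ⟨b', algebraMap _ K₁ a', Q, ha'M.1, ha'M.2, hAeR hQAe, hvQ, hb'.symm⟩
  -- run Lemma 4.7 along `v̂` and conclude
  have hind' : ∀ p m : Fin r → ℕ, ∏ i, O.valuation ((fun i => algebraMap A K (fA i)) i) ^ p i =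
      ∏ i, O.valuation ((fun i => algebraMap A K (fA i)) i) ^ m i → p = m := hind
  exact exists_adjoin_isRegularLocalRing_of_principalizedFrame k O hrk hAO hdomA r hr0 hdepK hP₁ hK₁
    ι hι O' hRO' halgO' hO hSuc hinj hS₀O hdomS₀ hres hSdim' Ae hSA hAS (t : Set K₁)
    t.finite_toSet hTO hreg x hx F u hFA huR hvu α hF hTR ⟨bF, hbF0, hbF⟩ hden C hAC hFC hC h₀ w
    hwR hvw β hh hβα hβne hdomAe (fun i => algebraMap A K (fA i)) hfR hfdvd hind'

end Base

end Literature.AlgebraicGeometry.Resolution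

end
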